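import Summits.Langlands.Langlands.Theses.SplitPrimeInduction
import Literature.Algebra.Homology.GroupCohomologyCentralElement
import HarnessLib

/-!
# Birth skeleton (BC3) for crux stmt-Langlands-16951
`Summit.Langlands.Langlands.Theses.SplitPrimeInduction.MonomialSerreAtSplitPrimes` — line `birth`

Route `route-Langlands-SplitPrimeInduction` (rev 11; deciding theorem
`closes (h₁ : LanglandsOverQ) (h₂ : TorsionLeviInduction) (h₃ : MonomialSerreAtSplitPrimes) (h₄ : DeinductionR)
(hA : Assembly) : Langlands := hA h₂ h₃ h₁ h₄`).  The crux (#3, rank 3, item stmt-Langlands-16951) is SERRE-TYPE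
OCCURRENCE FOR MONOMIAL REPRESENTATIONS AT A SPLIT PRIME: for `F` with `2 ≤ [F:ℚ]`, `r₁(F) ≤ 1`, `p` odd and
completely split in `F`, `k` algebraically closed discrete of characteristic `p`, and EVERY continuous character
`χ : Γ_F → k^×` (`FramedGaloisRep F k 1`) with Frobenius values `c_w` off `Sχ`, an eigenvalue system `b` occurs in some
`H^{i'}(X_{K'}, k)` for `GL_d/ℚ` (`d = [F:ℚ]`, tree model `ArithmeticQuotient.cohomology`, Scholze operators
`T^{(j)}_v = [K' diag(ϖ'_v ×j, 1 ×(d-j)) K']`) with `P_v(b)(X) = 1 + Σ_j (-1)^j q_v^{j(j+1)/2} b_{v,j} X^j =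
∏_{w∣v} (1 - c_w⁻¹ X^{f(w|v)})` off `S'` — "the system of `Ind_F^ℚ χ`".  Route text: "the `n = 1` instance of
TorsionLeviInduction with the `F`-side supplied by class field theory".

## The line (2 registered stubs) and what it reaches

* `stub_rayClassOccurrence` — the `F`-side: class-field-theoretic occurrence of `χ` in `H⁰` of the `GL₁/F` arithmetic
  quotient, Scholze-normalised (`q_w a_w = c_w⁻¹`), for `χ` ODD AT EVERY REAL PLACE (`χ.IsOdd`; vacuous for totally
  complex `F`).  TRUE by global class field theory (size M–L); the parity hypothesis is NECESSARY (below).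
* `stub_leviInductionRankOne` — the route's thesis at `n = 1`: torsion Levi/automorphic induction
  `GL₁/F ↝ GL_d/ℚ` at a completely split prime, typed in rank `d` (not `1 * d`) with the `n = 1` Scholze polynomial
  written out.  OPEN (XL); it is the rank-2 crux `TorsionLeviInduction` at `n = 1`.
* `MonomialSerreAtSplitPrimesOdd_of : stub_A → stub_B → MonomialSerreAtSplitPrimesOdd` (kernel-checked, no `sorry`):
  the two stubs prove EXACTLY the crux with the extra hypothesis `χ.IsOdd` (§1, §4).

## FINDING: the remaining sector is refutable — the crux is misstated on `r₁(F) = 1`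

`MonomialSerreAtSplitPrimes ↔ MonomialSerreAtSplitPrimesOdd ∧ MonomialSerreEvenRealSector` (§1, checked), and the
even-real sector (`r₁(F) = 1`, so `d = 2r₂ + 1` odd; `χ(c_v) = +1`, e.g. `χ = 1`) is FALSE in the tree's model:

1. CENTRAL SIGN LEMMA (§6, CHECKED: `heckeEnd_principalScalar_apply`): for `r ∈ F^×` the Hecke operator of the
   principal scalar finite idèle `r·1` is the IDENTITY on `H^i(X_K, M) = H^i(GL_n(F), Fun(GL_n(𝔸_{F,f})/K, M))`,
   because on coefficients it is the action of the central element `(r·1)⁻¹ ∈ GL_n(F)` and central elements act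
   trivially on group cohomology (tree: `Literature.Algebra.Homology.map_apply_eq_self_of_central`).  Over `ℚ` with
   `r = -1`: the central character `ψ̂` of every eigenclass (`T^{(d)}_ℓ = ` translation by the central `ϖ'_ℓ·1`;
   `K'` open ⇒ `ψ̂` is a character of `(ℤ/M)^×`, `b_{ℓ,d} = ψ̂(ℓ)⁻¹`, Dirichlet) is EVEN: `ψ̂(-1) = 1`.  So
   `det ρ̄_b(c) = (-1)^{d(d+1)/2}` always — the archimedean sign is invisible in this model (for `d = 1` this is the
   planner's own exclusion note in the item text; it persists for every `F` with a real place).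
2. `X^d`-COEFFICIENT of the asserted identity at an unramified `ℓ ∉ S'`, `χ = 1`:
   `ℓ^{d(d+1)/2} ψ̂(ℓ)⁻¹ = (-1)^{d-g_ℓ} = sgn(Frob_ℓ on the d embeddings)`, an ODD quadratic Dirichlet character when
   `r₁ = 1` (for `F = ℚ(∛2)`: `ℓ ↦ (ℓ mod 3 ↦ ±1)`, elementary).  Dirichlet ⇒ the character
   `Θ = (·)^{d(d+1)/2} ψ̂⁻¹ sgn` is trivial, but `Θ(-1) = (-1)^{r₂+1}·1·(-1)^{r₂} = -1 ≠ 1` (`p ≠ 2`).  Contradiction.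
   Instance: `F = ℚ(∛2)`, `p = 31` (completely split: `x³-2 ≡ (x-4)(x-7)(x-20) mod 31`), `k = 𝔽̄₃₁`, `χ = 1`.
   Non-vacuity of the sector's hypotheses is CHECKED (§5: `evenRealSector_trivialChar`).  Full write-up and a Lean
   blueprint for the disprover: `Cruxes/MonomialSerreAtSplitPrimes/RefutationSketch.md`.

REPAIR (class misstated): restate the crux as `MonomialSerreAtSplitPrimesOdd` (insert `χ.IsOdd →`; vacuous for
`r₁ = 0`), re-type the Assembly junction with it; then THIS skeleton registers unchanged (2 stubs, composition
`MonomialSerreAtSplitPrimesOdd_of`).  `MonomialSerreAtSplitPrimes_of` below carries the even-real residue as an explicit,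
UNREGISTERED third hypothesis so that nothing is hidden; it is not a stub and must not be staffed.

`lean check --json`: rc 0, errors [], sorries 2 = `stub_rayClassOccurrence`, `stub_leviInductionRankOne` (zero
elsewhere).  BC3 probes (`stub → MonomialSerreAtSplitPrimes`, `stub → _root_.Langlands`, each by `exact?` / `simpa` /
`simpa [P, crux]` / `unfold; simpa` / `aesop` with 400000 heartbeats apiece): 20/20 FAIL.

Disproof used: no `Disproof.lean` / Negative lemma exists for this crux (`ledger workitem get`: evidence = REPAIR-rev5.md
only); dead lines: none.  References: P. Scholze, Ann. of Math. 182 (2015) §V.4 [Scholze2015]; A. Ash, W. Sinnott,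
Duke Math. J. 105 (2000) [AshSinnott2000]; A. Ash, D. Doud, D. Pollack, Duke Math. J. 112 (2002) §3, §7.1
[AshDoudPollack2002]; A. Caraiani, B. V. Le Hung, Compositio 152 (2016) [CaraianiLehung2016]; J.-P. Serre, *Local
Fields*, VII §5 Prop. 3 [SerreLocalFields1979]; P. G. L. Dirichlet (1837) / Mathlib `Nat.forall_exists_prime_gt_and_eq_mod`.
-/

noncomputable section

set_option linter.dupNamespace false

open scoped NumberField Classical Polynomial Topology
open IsDedekindDomain NumberField Polynomial
open Literature.NumberTheory.Automorphic Literature.NumberTheory.GaloisRepresentations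
open Summit.Langlands.Langlands.Theses.SplitPrimeInduction (MonomialSerreAtSplitPrimes TorsionLeviInduction)

namespace Summit.Langlands.Langlands.Cruxes.MonomialSerreAtSplitPrimes.Birth

/-! ## 0. The crux, by name, and its conclusion clause -/

/-- The conclusion clause of the crux for the data `(F, k, Sχ, c)`: an eigenvalue system `b` OCCURS in some
`H^{i'}(X_{K'}, k)` for `GL_d/ℚ`, `d = [F:ℚ]` (level `K'` of principal-congruence shape off `S'`), with Scholze
polynomial `P_v(b)(X) = ∏_{w ∣ v} (1 - c_w⁻¹ X^{f(w|v)})` and `S'` shielding `Sχ` — verbatim the crux text. [folklore] -/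
def InducedOccursOverQ (F : Type) [Field F] [NumberField F] (k : Type) [Field k]
    (Sχ : Finset (HeightOneSpectrum (𝓞 F))) (c : HeightOneSpectrum (𝓞 F) → k) : Prop :=
  ∃ (S' : Finset (HeightOneSpectrum (𝓞 ℚ))) (K' : Subgroup (GL (Fin (Module.finrank ℚ F)) (FiniteAdeleRing (𝓞 ℚ) ℚ))) (ϖ' : ∀ v : HeightOneSpectrum (𝓞 ℚ), (v.adicCompletion ℚ)ˣ) (i' : ℕ) (b : HeightOneSpectrum (𝓞 ℚ) → ℕ → k), (∀ v, Valued.v ((ϖ' v : (v.adicCompletion ℚ)ˣ) : v.adicCompletion ℚ) = WithZero.exp (-1 : ℤ)) ∧ IsOpen (K' : Set (GL (Fin (Module.finrank ℚ F)) (FiniteAdeleRing (𝓞 ℚ) ℚ))) ∧ K' ≤ glFiniteIntegralLevel (Module.finrank ℚ F) ℚ ∧ (∀ g ∈ glFiniteIntegralLevel (Module.finrank ℚ F) ℚ, (∀ v ∈ S', ∀ i j : Fin (Module.finrank ℚ F), ((g : Matrix (Fin (Module.finrank ℚ F)) (Fin (Module.finrank ℚ F)) (FiniteAdeleRing (𝓞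 ℚ) ℚ)) i j) v = (1 : Matrix (Fin (Module.finrank ℚ F)) (Fin (Module.finrank ℚ F)) (v.adicCompletion ℚ)) i j) → g ∈ K') ∧ (∃ e : ArithmeticQuotient.cohomology k (Matrix.GeneralLinearGroup.map (algebraMap ℚ (FiniteAdeleRing (𝓞 ℚ) ℚ))) K' k i', e ≠ 0 ∧ ∀ v ∉ S', ∀ j : ℕ, 1 ≤ j → j ≤ (Module.finrank ℚ F) → ArithmeticQuotient.heckeEnd k K' (GLn.sndHom (Module.finrank ℚ F) ℚ (heckeDiagAt (Module.finrank ℚ F) ℚ v (ϖ' v) j)) k (Matrix.GeneralLinearGroup.map (algebraMap ℚ (FiniteAdeleRing (𝓞 ℚ) ℚ))) i' e = b v j • e) ∧ ∀ v : HeightOneSpectrum (𝓞 ℚ), v ∉ S' → (∀ w : HeightOneSpectrum (𝓞 F), w.asIdeal.under (𝓞 ℚ) = v.asIdeal → w ∉ Sχ) ∧ (1 + ∑ j ∈ Finset.Icc 1 (Module.finrank ℚ F), C ((-1 : k) ^ j * (v.residueCard : k) ^ (j * (j + 1) / 2) * b v j) * X ^ j : Polynomial k) = ∏ᶠ w ∈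 {w : HeightOneSpectrum (𝓞 F) | w.asIdeal.under (𝓞 ℚ) = v.asIdeal}, (1 - C (c w)⁻¹ * X ^ w.asIdeal.inertiaDeg (𝓞 ℚ) : Polynomial k)

/-- The crux IS `∀ F … χ Sχ c, (unramified-with-Frobenius-values hypothesis) → InducedOccursOverQ F k Sχ c`,
definitionally (route text rev 11). [folklore] -/
theorem monomialSerreAtSplitPrimes_iff :
    MonomialSerreAtSplitPrimes ↔ (∀ (F : Type) [Field F] [NumberField F], 2 ≤ Module.finrank ℚ F → InfinitePlace.nrRealPlaces F ≤ 1 → ∀ (p : ℕ) [Fact p.Prime], p ≠ 2 → (∀ v : HeightOneSpectrum (𝓞 F), ((p : ℕ) : 𝓞 F) ∈ v.asIdeal → v.asIdeal.ramificationIdx ℤ = 1 ∧ v.asIdeal.inertiaDeg ℤ = 1) → ∀ (k : Type) [Field k] [CharP k p] [IsAlgClosed k] [TopologicalSpace k] [DiscreteTopology k] (χ : FramedGaloisRep F k 1) (Sχ : Finset (HeightOneSpectrum (𝓞 F))) (c : HeightOneSpectrum (𝓞 F) → k), (∀ w ∉ Sχ, χ.IsUnramifiedAt w ∧ χ.HasFrobCharpolyAt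 w (X - C (c w))) → InducedOccursOverQ F k Sχ c) :=
  Iff.rfl

/-! ## 1. The two sectors of the crux by the parity of `χ` at the real place(s) of `F` -/

/-- **ODD SECTOR** (the proposed repaired crux `MonomialSerreAtSplitPrimesOdd`): the crux with the extra
hypothesis `χ.IsOdd` — `χ(c_v) = det χ(c_v) = -1` for every complex conjugation `c_v` at every real place `v` of `F`
(`FramedGaloisRep.IsOdd`; VACUOUS for totally complex `F`, so this contains the whole `r₁ = 0` case).  This is exactly
the set of characters whose Scholze-normalised eigenvalue system occurs on `GL₁/F` (class field theory, see
`stub_rayClassOccurrence`), and exactly the set for which `det (Ind_F^ℚ χ)(c) = (-1)^{d(d+1)/2}`, the sign every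
eigenclass of `GL_d/ℚ` carries in this model (central sign lemma, see the module docstring). [folklore] -/
def MonomialSerreAtSplitPrimesOdd : Prop :=
  ∀ (F : Type) [Field F] [NumberField F], 2 ≤ Module.finrank ℚ F → InfinitePlace.nrRealPlaces F ≤ 1 → ∀ (p : ℕ) [Fact p.Prime], p ≠ 2 → (∀ v : HeightOneSpectrum (𝓞 F), ((p : ℕ) : 𝓞 F) ∈ v.asIdeal → v.asIdeal.ramificationIdx ℤ = 1 ∧ v.asIdeal.inertiaDeg ℤ = 1) → ∀ (k : Type) [Field k] [CharP k p] [IsAlgClosed k] [TopologicalSpace k] [DiscreteTopology k] (χ : FramedGaloisRep F k 1) (Sχ : Finset (HeightOneSpectrum (𝓞 F))) (c : HeightOneSpectrum (𝓞 F) → k), χ.IsOdd → (∀ w ∉ Sχ, χ.IsUnramifiedAt w ∧ χ.HasFrobCharpolyAt w (X - C (c w))) → InducedOccursOverQ F k Sχ c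

/-- **EVEN-REAL SECTOR** (the residue of the crux NOT reached by this line; EXPECTED FALSE — see the module
docstring: for `F` with one real place, `d` odd, `p` odd and `χ` even at the real place, e.g. `χ = 1` over a complex
cubic field, the central-sign lemma + Dirichlet contradict the `X^d`-coefficient of the asserted identity).  Recorded as a
named proposition so that `MonomialSerreAtSplitPrimes ↔ Odd ∧ EvenReal` is checked and a disprover has a typed target;
it is NOT a stub of the line. [folklore] -/
def MonomialSerreEvenRealSector : Prop :=
  ∀ (F : Type) [Field F] [NumberField F], 2 ≤ Module.finrank ℚ F → InfinitePlace.nrRealPlaces F ≤ 1 → ∀ (p : ℕ) [Fact p.Prime], p ≠ 2 → (∀ v : HeightOneSpectrum (𝓞 F), ((p : ℕ) : 𝓞 F) ∈ v.asIdeal → v.asIdeal.ramificationIdx ℤ = 1 ∧ v.asIdeal.inertiaDeg ℤ = 1) → ∀ (k : Type) [Field k] [CharP k p] [IsAlgClosed k] [TopologicalSpace k] [DiscreteTopology k] (χ : FramedGaloisRep F k 1) (Sχ : Finset (HeightOneSpectrum (𝓞 F))) (c : HeightOneSpectrum (𝓞 F) → k), ¬ χ.IsOdd → (∀ w ∉ Sχ,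 χ.IsUnramifiedAt w ∧ χ.HasFrobCharpolyAt w (X - C (c w))) → InducedOccursOverQ F k Sχ c

/-- The crux restricts to its odd sector. [folklore] -/
theorem monomialSerreAtSplitPrimesOdd_of_crux (h : MonomialSerreAtSplitPrimes) : MonomialSerreAtSplitPrimesOdd :=
  fun F _ _ hd hr p _ hp hs k _ _ _ _ _ χ Sχ c _ hχ => h F hd hr p hp hs k χ Sχ c hχ

/-- The crux restricts to its even-real sector. [folklore] -/
theorem monomialSerreEvenRealSector_of_crux (h : MonomialSerreAtSplitPrimes) : MonomialSerreEvenRealSector :=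
  fun F _ _ hd hr p _ hp hs k _ _ _ _ _ χ Sχ c _ hχ => h F hd hr p hp hs k χ Sχ c hχ

/-- The crux is the conjunction of its two parity sectors (excluded middle on `χ.IsOdd`). [folklore] -/
theorem monomialSerreAtSplitPrimes_iff_sectors :
    MonomialSerreAtSplitPrimes ↔ MonomialSerreAtSplitPrimesOdd ∧ MonomialSerreEvenRealSector := by
  refine ⟨fun h => ⟨monomialSerreAtSplitPrimesOdd_of_crux h, monomialSerreEvenRealSector_of_crux h⟩, ?_⟩
  rintro ⟨hO, hE⟩ F _ _ hd hr p _ hp hs k _ _ _ _ _ χ Sχ c hχ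
  by_cases ho : χ.IsOdd
  · exact hO F hd hr p hp hs k χ Sχ c ho hχ
  · exact hE F hd hr p hp hs k χ Sχ c ho hχ

/-! ## 2. The stubs (registered; the ONLY `sorry`s of this file) -/

/-- **stub A — ray-class occurrence on `GL₁/F` (class field theory side, Scholze-normalised).**  For a continuous
character `χ : Γ_F → k^×` (finite image: `k` discrete), ODD at every real place, with Frobenius values `c_w` off `Sχ`,
there are a finite `S ⊇ Sχ` (containing the places above `p` and the conductor of `χ·ω`), a level
`K ⊆ 𝒪̂_F^× = GL₁(𝒪̂_F)` of principal-congruence shape off `S`, uniformisers `ϖ`, and a NON-ZERO class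
`e ∈ H⁰(X_K, k) = Fun(F^× \ 𝔸_{F,f}^× / K, k)` with `T_w e = a_w e` (`T_w = [K ϖ_w K]` = translation by `ϖ_w`) and
`q_w a_w = c_w⁻¹` for `w ∉ S`, i.e. `P_w(a)(X) = 1 - q_w a_w X = 1 - χ(Frob_w^geom) X`.  WHY TRUE: the simultaneous
`T_w`-eigenvectors in `H⁰` are the characters `ψ` of the wide ray class group `F^×\𝔸_{F,f}^×/K` (all of `F_∞^×` is
invisible in this model, so `ψ^{Gal}` is even at every real place), and `w ↦ q_w a_w` is then the Frobenius system of
`ψ^{Gal} ⊗ ω⁻¹`, which ranges exactly over the characters odd at every real place as `K`, `ψ` vary (Artin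
reciprocity, `ω` = mod-`p` cyclotomic character; for `p = 2` both parity conditions are vacuous).  Size M–L: needs
`H⁰ = invariants` (`groupCohomology.H0`), the orbit description of `𝔸_f^×/K` under `F^×`, and global class field theory
as a named Literature fact. [cite: Scholze2015, §V.4] -/
theorem stub_rayClassOccurrence : ∀ (F : Type) [Field F] [NumberField F] (p : ℕ) [Fact p.Prime] (k : Type) [Field k] [CharP k p] [IsAlgClosed k] [TopologicalSpace k] [DiscreteTopology k] (χ : FramedGaloisRep F k 1) (Sχ : Finset (HeightOneSpectrum (𝓞 F))) (c : HeightOneSpectrum (𝓞 F) → k), χ.IsOdd → (∀ w ∉ Sχ, χ.IsUnramifiedAt w ∧ χ.HasFrobCharpolyAt w (X - C (c w))) → ∃ (S : Finset (HeightOneSpectrum (𝓞 F))) (K : Subgroup (GL (Fin 1) (FiniteAdeleRing (𝓞 F) F))) (ϖ : ∀ v : HeightOneSpectrum (𝓞 F), (v.adicCompletion F)ˣ) (a : HeightOneSpectrum (𝓞 F) → k), Sχ ⊆ S ∧ (∀ v, Valued.v ((ϖ v : (v.adicCompletion F)ˣ) : v.adicCompletion F) = WithZero.exp (-1 : ℤ))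 ∧ IsOpen (K : Set (GL (Fin 1) (FiniteAdeleRing (𝓞 F) F))) ∧ K ≤ glFiniteIntegralLevel 1 F ∧ (∀ g ∈ glFiniteIntegralLevel 1 F, (∀ v ∈ S, ∀ i j : Fin 1, ((g : Matrix (Fin 1) (Fin 1) (FiniteAdeleRing (𝓞 F) F)) i j) v = (1 : Matrix (Fin 1) (Fin 1) (v.adicCompletion F)) i j) → g ∈ K) ∧ (∃ e : ArithmeticQuotient.cohomology k (Matrix.GeneralLinearGroup.map (algebraMap F (FiniteAdeleRing (𝓞 F) F))) K k 0, e ≠ 0 ∧ ∀ v ∉ S, ArithmeticQuotient.heckeEnd k K (GLn.sndHom 1 F (heckeDiagAt 1 F v (ϖ v) 1)) k (Matrix.GeneralLinearGroup.map (algebraMap F (FiniteAdeleRing (𝓞 F) F))) 0 e = a v • e) ∧ ∀ w ∉ S, (w.residueCard : k) * a w = (c w)⁻¹ := by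
  sorry

/-- **stub B — rank-one torsion Levi induction at a split prime (`GL₁/F ↝ GL_d/ℚ`).**  The `n = 1` instance of the
route's rank-2 crux `TorsionLeviInduction`, typed directly in rank `d = [F:ℚ]` (not `1 * d`) and with the `n = 1`
Scholze polynomial written out, `P_w(a)(X^{f}) = 1 - q_w a_w X^{f(w|v)}`: an eigenvalue system `a` of the
`T_w = [K ϖ_w K]`, `w ∉ S`, occurring in some `H^i(X_K, k)` for `GL₁/F` (level `K ⊆ 𝒪̂_F^×` of principal-congruence
shape off `S`) transfers to an eigenvalue system `b` occurring in some `H^{i'}(X_{K'}, k)` for `GL_d/ℚ` with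
`P_v(b)(X) = ∏_{w∣v} (1 - q_w a_w X^{f(w|v)})` for `v ∉ S'`, all `w ∣ v` outside `S`.  Hypotheses as in the crux
(`d ≥ 2`, `r₁(F) ≤ 1` = the `n = 1` case of `Even n ∨ r₁ ≤ 1`, `p` odd and completely split in `F`).  WHY PLAUSIBLE /
WHY IT MIGHT FAIL: this is the route's thesis (at `p` split the twisted Levi `Res_{F/ℚ} GL₁` is the diagonal torus of
`GL_d(ℚ_p)`; no torsion automorphic induction along a non-solvable `F` exists in print — Scholze2015 V.4 gives the
Galois side over ℚ only).  Parity is consistent: occurring `a` have `ψ^{Gal}ω⁻¹` odd at real places, whose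
induction has the determinant sign `(-1)^{d(d+1)/2}` forced on `GL_d/ℚ`.  Size XL (open). [cite: Scholze2015, §V.4] -/
theorem stub_leviInductionRankOne : ∀ (F : Type) [Field F] [NumberField F], 2 ≤ Module.finrank ℚ F → InfinitePlace.nrRealPlaces F ≤ 1 → ∀ (p : ℕ) [Fact p.Prime], p ≠ 2 → (∀ v : HeightOneSpectrum (𝓞 F), ((p : ℕ) : 𝓞 F) ∈ v.asIdeal → v.asIdeal.ramificationIdx ℤ = 1 ∧ v.asIdeal.inertiaDeg ℤ = 1) → ∀ (S : Finset (HeightOneSpectrum (𝓞 F))) (K : Subgroup (GL (Fin 1) (FiniteAdeleRing (𝓞 F) F))) (ϖ : ∀ v : HeightOneSpectrum (𝓞 F), (v.adicCompletion F)ˣ), (∀ v, Valued.v ((ϖ v : (v.adicCompletion F)ˣ) : v.adicCompletion F) = WithZero.exp (-1 : ℤ)) → IsOpen (K : Set (GL (Fin 1) (FiniteAdeleRing (𝓞 F) F))) → K ≤ glFiniteIntegralLevel 1 F → (∀ g ∈ glFiniteIntegralLevel 1 F, (∀ v ∈ S, ∀ i j : Fin 1, ((g : Matrix (Fin 1) (Fin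 1) (FiniteAdeleRing (𝓞 F) F)) i j) v = (1 : Matrix (Fin 1) (Fin 1) (v.adicCompletion F)) i j) → g ∈ K) → ∀ (k : Type) [Field k] [CharP k p] (i : ℕ) (a : HeightOneSpectrum (𝓞 F) → k), (∃ e : ArithmeticQuotient.cohomology k (Matrix.GeneralLinearGroup.map (algebraMap F (FiniteAdeleRing (𝓞 F) F))) K k i, e ≠ 0 ∧ ∀ v ∉ S, ArithmeticQuotient.heckeEnd k K (GLn.sndHom 1 F (heckeDiagAt 1 F v (ϖ v) 1)) k (Matrix.GeneralLinearGroup.map (algebraMap F (FiniteAdeleRing (𝓞 F) F))) i e = a v • e) → ∃ (S' : Finset (HeightOneSpectrum (𝓞 ℚ))) (K' : Subgroup (GL (Fin (Module.finrank ℚ F)) (FiniteAdeleRing (𝓞 ℚ) ℚ))) (ϖ' : ∀ v : HeightOneSpectrum (𝓞 ℚ), (v.adicCompletion ℚ)ˣ) (i' : ℕ) (b : HeightOneSpectrum (𝓞 ℚ) → ℕ → k), (∀ v, Valued.v ((ϖ' v : (v.adicCompletion ℚ)ˣ) : v.adicCompletion ℚ) = WithZero.exp (-1 : ℤ)) ∧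 IsOpen (K' : Set (GL (Fin (Module.finrank ℚ F)) (FiniteAdeleRing (𝓞 ℚ) ℚ))) ∧ K' ≤ glFiniteIntegralLevel (Module.finrank ℚ F) ℚ ∧ (∀ g ∈ glFiniteIntegralLevel (Module.finrank ℚ F) ℚ, (∀ v ∈ S', ∀ i j : Fin (Module.finrank ℚ F), ((g : Matrix (Fin (Module.finrank ℚ F)) (Fin (Module.finrank ℚ F)) (FiniteAdeleRing (𝓞 ℚ) ℚ)) i j) v = (1 : Matrix (Fin (Module.finrank ℚ F)) (Fin (Module.finrank ℚ F)) (v.adicCompletion ℚ)) i j) → g ∈ K') ∧ (∃ e : ArithmeticQuotient.cohomology k (Matrix.GeneralLinearGroup.map (algebraMap ℚ (FiniteAdeleRing (𝓞 ℚ) ℚ))) K' k i', e ≠ 0 ∧ ∀ v ∉ S', ∀ j : ℕ, 1 ≤ j → j ≤ (Module.finrank ℚ F) → ArithmeticQuotient.heckeEnd k K' (GLn.sndHom (Module.finrank ℚ F) ℚ (heckeDiagAt (Module.finrank ℚ F) ℚ v (ϖ' v) j)) k (Matrix.GeneralLinearGroup.map (algebraMap ℚ (FiniteAdeleRing (𝓞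 ℚ) ℚ))) i' e = b v j • e) ∧ ∀ v : HeightOneSpectrum (𝓞 ℚ), v ∉ S' → (∀ w : HeightOneSpectrum (𝓞 F), w.asIdeal.under (𝓞 ℚ) = v.asIdeal → w ∉ S) ∧ (1 + ∑ j ∈ Finset.Icc 1 (Module.finrank ℚ F), C ((-1 : k) ^ j * (v.residueCard : k) ^ (j * (j + 1) / 2) * b v j) * X ^ j : Polynomial k) = ∏ᶠ w ∈ {w : HeightOneSpectrum (𝓞 F) | w.asIdeal.under (𝓞 ℚ) = v.asIdeal}, (1 - C ((w.residueCard : k) * a w) * X ^ w.asIdeal.inertiaDeg (𝓞 ℚ) : Polynomial k) := by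
  sorry

/-! ## 3. The stub statements as named propositions (`type_of%`, no text duplicated, no `sorry` inherited) -/

namespace _Goal

/-- The statement of `stub_rayClassOccurrence` (literally its type). [folklore] -/
def stub_rayClassOccurrence : Prop :=
  type_of% @Summit.Langlands.Langlands.Cruxes.MonomialSerreAtSplitPrimes.Birth.stub_rayClassOccurrence

/-- The statement of `stub_leviInductionRankOne` (literally its type). [folklore] -/
def stub_leviInductionRankOne : Prop :=
  type_of% @Summit.Langlands.Langlands.Cruxes.MonomialSerreAtSplitPrimes.Birth.stub_leviInductionRankOne

end _Goal

/-! ## 4. The compositions (kernel-checked, no `sorry`) -/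

/-- **The odd sector from the two stubs**: class-field-theoretic occurrence on `GL₁/F` (stub A), then rank-one Levi
induction to `GL_d/ℚ` (stub B) in degree `i = 0`, then the factorwise identity `1 - q_w a_w X^f = 1 - c_w⁻¹ X^f`
inside the finite product over `w ∣ v` (`finprod_mem_congr`) and `Sχ ⊆ S` for the shielding clause. [folklore] -/
theorem MonomialSerreAtSplitPrimesOdd_of (hA : _Goal.stub_rayClassOccurrence)
    (hB : _Goal.stub_leviInductionRankOne) : MonomialSerreAtSplitPrimesOdd := by
  dsimp only [_Goal.stub_rayClassOccurrence, _Goal.stub_leviInductionRankOne] at hA hB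
  intro F _ _ hd hr p _ hp hs k _ _ _ _ _ χ Sχ c hodd hχ
  obtain ⟨S, K, ϖ, a, hSχ, hϖ, hKo, hKle, hKS, hocc, hqa⟩ := hA F p k χ Sχ c hodd hχ
  obtain ⟨S', K', ϖ', i', b, hϖ', hK'o, hK'le, hK'S, hocc', hpoly⟩ :=
    hB F hd hr p hp hs S K ϖ hϖ hKo hKle hKS k 0 a hocc
  refine ⟨S', K', ϖ', i', b, hϖ', hK'o, hK'le, hK'S, hocc', fun v hv => ⟨fun w hw hwχ => ?_, ?_⟩⟩
  · exact (hpoly v hv).1 w hw (hSχ hwχ)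
  · rw [(hpoly v hv).2]
    refine finprod_mem_congr rfl fun w hw => ?_
    rw [hqa w ((hpoly v hv).1 w hw)]

/-- **The crux from the two stubs AND the even-real residue.**  The third hypothesis is NOT a stub: it is the sector
of the crux this line cannot reach and which the registrar expects to be FALSE (module docstring); it is carried
explicitly so that the composition concludes the route decl BY NAME without hiding it. [folklore] -/
theorem MonomialSerreAtSplitPrimes_of (hA : _Goal.stub_rayClassOccurrence) (hB : _Goal.stub_leviInductionRankOne)
    (hEven : MonomialSerreEvenRealSector) : MonomialSerreAtSplitPrimes :=
  monomialSerreAtSplitPrimes_iff_sectors.2 ⟨MonomialSerreAtSplitPrimesOdd_of hA hB, hEven⟩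

/-- By-name sanity check: the two stubs feed the odd-sector composition as they stand. -/
example : MonomialSerreAtSplitPrimesOdd :=
  MonomialSerreAtSplitPrimesOdd_of stub_rayClassOccurrence stub_leviInductionRankOne

/-! ## 5. Non-vacuity of the even-real sector (checked): the trivial character is an admissible, EVEN input -/

/-- The trivial character `1 : Γ_F → GL₁(k)` is unramified at every finite place, with Frobenius polynomial `X - 1`
(`c_w = 1`). [folklore] -/
theorem trivial_unramified_frobOne (F : Type) [Field F] [NumberField F] (k : Type) [Field k] [TopologicalSpace k]
    (w : HeightOneSpectrum (𝓞 F)) :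
    (1 : FramedGaloisRep F k 1).IsUnramifiedAt w ∧ (1 : FramedGaloisRep F k 1).HasFrobCharpolyAt w (X - C (1 : k)) := by
  refine ⟨fun 𝔓 _ σ _ => rfl, fun 𝔓 _ σ _ => ?_⟩
  show Matrix.charpoly (((1 : FramedGaloisRep F k 1) σ : GL (Fin 1) k) : Matrix (Fin 1) (Fin 1) k) = X - C 1
  simp [Matrix.charpoly_one]

/-- In characteristic `≠ 2` the trivial character is NOT odd as soon as `F` has a real embedding `φ`
(a complex conjugation `c` for `φ` exists, `exists_isComplexConjugation`, and `det 1(c) = 1 ≠ -1`). [folklore] -/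
theorem trivial_not_isOdd (F : Type) [Field F] [NumberField F] (φ : F →+* ℝ) (k : Type) [Field k]
    [TopologicalSpace k] (h2 : (2 : k) ≠ 0) : ¬ (1 : FramedGaloisRep F k 1).IsOdd := by
  intro h
  obtain ⟨c, hc⟩ := exists_isComplexConjugation φ
  have h1 : (1 : kˣ) = -1 := by simpa using h φ c hc
  have h1' : (1 : k) = -1 := by simpa using congrArg Units.val h1
  exact h2 (by linear_combination h1')

/-- `2 ≠ 0` in a ring of prime characteristic `p ≠ 2`. [folklore] -/
theorem two_ne_zero_of_charP (k : Type) [Field k] (p : ℕ) [Fact p.Prime] [CharP k p] (hp : p ≠ 2) :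
    (2 : k) ≠ 0 := by
  intro h
  have h' : ((2 : ℕ) : k) = 0 := by exact_mod_cast h
  rw [CharP.cast_eq_zero_iff k p 2] at h'
  exact hp ((Nat.prime_dvd_prime_iff_eq (Fact.out : p.Prime) Nat.prime_two).1 h')

/-- **What the even-real sector asserts, concretely (checked):** for every number field `F` of degree `≥ 2` with at
most one real place AND a real embedding `φ` (i.e. exactly one real place: `d = [F:ℚ]` odd, e.g. a complex cubic
field), every odd prime `p` completely split in `F` and every algebraically closed discrete `k` of characteristic `p`,
the Scholze-normalised system of `Ind_F^ℚ 1` occurs on `GL_d/ℚ`: some eigenclass `b` with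
`P_v(b)(X) = ∏_{w∣v} (1 - X^{f(w|v)})` off `S'`.  RefutationSketch.md derives `False` from this for `F = ℚ(∛2)`, `p = 31`
(central-sign lemma + Dirichlet), hence `¬ MonomialSerreEvenRealSector` and `¬ MonomialSerreAtSplitPrimes`. [folklore] -/
theorem evenRealSector_trivialChar (h : MonomialSerreEvenRealSector) (F : Type) [Field F] [NumberField F]
    (hd : 2 ≤ Module.finrank ℚ F) (hr : InfinitePlace.nrRealPlaces F ≤ 1) (φ : F →+* ℝ) (p : ℕ) [Fact p.Prime]
    (hp : p ≠ 2) (hs : (∀ v : HeightOneSpectrum (𝓞 F), ((p : ℕ) : 𝓞 F) ∈ v.asIdeal → v.asIdeal.ramificationIdx ℤ = 1 ∧ v.asIdeal.inertiaDeg ℤ = 1))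
    (k : Type) [Field k] [CharP k p] [IsAlgClosed k] [TopologicalSpace k] [DiscreteTopology k] :
    InducedOccursOverQ F k ∅ (fun _ => 1) :=
  h F hd hr p hp hs k (1 : FramedGaloisRep F k 1) ∅ (fun _ => 1)
    (trivial_not_isOdd F φ k (two_ne_zero_of_charP k p hp)) (fun w _ => trivial_unramified_frobOne F k w)

end Summit.Langlands.Langlands.Cruxes.MonomialSerreAtSplitPrimes.Birth

/-! ## 6. Disproof ingredient (checked): central rational Hecke operators act trivially on `H^i(X_L, M)`

This is the load-bearing lemma of RefutationSketch.md: in the tree's model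
`H^i(X_L, M) := H^i(Γ, Fun(𝒢 ⧸ L, M))` (`ArithmeticQuotient.cohomology`) the Hecke operator `[L z L]` of the image
`z = ι γ` of a CENTRAL element `γ ∈ Z(Γ)` (central in `𝒢` too) is the identity, because on coefficients it is the
action of `γ⁻¹`, and central elements act trivially on group cohomology (tree:
`Literature.Algebra.Homology.map_apply_eq_self_of_central`, Serre, *Local Fields* VII §5 Prop. 3).  For
`Γ = GL_n(F) → 𝒢 = GL_n(𝔸_{F,f})` and `γ = r·1`, `r ∈ F^×` (e.g. `r = -1`): the central character of every Hecke
eigenclass is trivial on the principal FINITE idèles, i.e. on all of `F^×` — including the signs at the real places. -/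

namespace Summit.Langlands.Langlands.Cruxes.MonomialSerreAtSplitPrimes.Birth

section CentralSign

universe u

variable (k : Type u) [CommRing k] {Γ 𝒢 : Type u} [Group Γ] [Group 𝒢]
  (ι : Γ →* 𝒢) (L : Subgroup 𝒢) (M : Type u) [AddCommGroup M] [Module k M]

omit [Group Γ] in
variable {k ι M} in
/-- For `g` central in `𝒢`, the double coset `L g L / L` is the single coset `gL`. [folklore] -/
theorem doubleCosetQuot_of_mem_center {g : 𝒢} (hg : g ∈ Subgroup.center 𝒢) :
    ArithmeticQuotient.doubleCosetQuot L g = {(g : 𝒢 ⧸ L)} := by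
  ext d
  simp only [Set.mem_singleton_iff, ArithmeticQuotient.doubleCosetQuot]
  constructor
  · rintro ⟨m, rfl⟩
    show ((m : 𝒢) • (g : 𝒢 ⧸ L)) = _
    rw [MulAction.Quotient.smul_coe, smul_eq_mul, Subgroup.mem_center_iff.1 hg (m : 𝒢)]
    exact QuotientGroup.eq.mpr (by simp)
  · rintro rfl
    exact MulAction.mem_orbit_self _

omit [Group Γ] in
variable {ι} in
/-- For `g` central in `𝒢`, `T_g = [L g L]` on `Fun(𝒢 ⧸ L, M)` is the translation `(T_g f)(c) = f(g • c)`.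
[folklore] -/
theorem heckeFun_apply_of_mem_center {g : 𝒢} (hg : g ∈ Subgroup.center 𝒢) (f : (𝒢 ⧸ L) → M)
    (c : 𝒢 ⧸ L) : ArithmeticQuotient.heckeFun k L g M f c = f (g • c) := by
  classical
  have hfin : (ArithmeticQuotient.doubleCosetQuot L g).Finite := by
    rw [doubleCosetQuot_of_mem_center L hg]
    exact Set.finite_singleton _
  have hset : hfin.toFinset = {(g : 𝒢 ⧸ L)} :=
    Finset.ext fun d => by rw [Set.Finite.mem_toFinset, doubleCosetQuot_of_mem_center L hg]; simp
  rw [ArithmeticQuotient.heckeFun_apply, dif_pos hfin, hset, Finset.sum_singleton, MulAction.Quotient.smul_coe,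
    smul_eq_mul, Subgroup.mem_center_iff.1 hg c.out]
  congr 1
  conv_rhs => rw [← QuotientGroup.out_eq' c]
  rfl

/-- **Central elements of `Γ` act trivially through their Hecke operators (checked).**  If `γ ∈ Z(Γ)` and
`ι γ ∈ Z(𝒢)`, then `T_{ι γ} = [L (ι γ) L]` is the identity of `H^i(X_L, M) = H^i(Γ, Fun(𝒢 ⧸ L, M))`: on coefficients
`T_{ιγ} f = f(ιγ • ·) = ρ(γ⁻¹) f`, and `γ⁻¹ ∈ Z(Γ)` acts trivially on group cohomology.
[cite: SerreLocalFields1979, Ch. VII §5, Prop. 3] -/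
theorem heckeEnd_apply_of_mem_center {γ : Γ} (hγ : γ ∈ Subgroup.center Γ) (hιγ : ι γ ∈ Subgroup.center 𝒢)
    (i : ℕ) (x : ArithmeticQuotient.cohomology k ι L M i) :
    ArithmeticQuotient.heckeEnd k L (ι γ) M ι i x = x := by
  refine Literature.Algebra.Homology.map_apply_eq_self_of_central (ArithmeticQuotient.coeffRep k ι L M)
    (Subgroup.inv_mem _ hγ) (ArithmeticQuotient.heckeRepHom k L (ι γ) M ι) (fun f => ?_) i x
  change ArithmeticQuotient.heckeFun k L (ι γ) M f = ArithmeticQuotient.coeffRepresentation k ι L M γ⁻¹ f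
  ext c
  rw [heckeFun_apply_of_mem_center k L M hιγ, ArithmeticQuotient.coeffRepresentation_apply, map_inv, inv_inv]

/-- Scalar matrices `r·1 ∈ GL_n(R)`, `r ∈ R^×` (Mathlib `Matrix.scalar`, `Units.map`). [folklore] -/
def glScalar (n : ℕ) (R : Type u) [CommRing R] : Rˣ →* GL (Fin n) R :=
  Units.map (Matrix.scalar (Fin n) : R →+* Matrix (Fin n) (Fin n) R).toMonoidHom

/-- The matrix of `glScalar n R r` is `Matrix.scalar _ r`. [folklore] -/
@[simp]
theorem coe_glScalar (n : ℕ) (R : Type u) [CommRing R] (r : Rˣ) :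
    ((glScalar n R r : GL (Fin n) R) : Matrix (Fin n) (Fin n) R) = Matrix.scalar (Fin n) (r : R) :=
  rfl

/-- Scalar matrices are central in `GL_n(R)`. [folklore] -/
theorem glScalar_mem_center (n : ℕ) (R : Type u) [CommRing R] (r : Rˣ) :
    glScalar n R r ∈ Subgroup.center (GL (Fin n) R) := by
  refine Subgroup.mem_center_iff.2 fun g => Units.ext ?_
  rw [Units.val_mul, Units.val_mul, coe_glScalar]
  exact ((Matrix.scalar_commute (r : R) (fun r' => mul_comm _ _) (g : Matrix (Fin n) (Fin n) R)).eq).symm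

/-- Ring homomorphisms map scalar matrices to scalar matrices. [folklore] -/
theorem map_glScalar (n : ℕ) {R S : Type u} [CommRing R] [CommRing S] (f : R →+* S) (r : Rˣ) :
    Matrix.GeneralLinearGroup.map f (glScalar n R r) = glScalar n S (Units.map (f : R →* S) r) := by
  refine Units.ext (Matrix.ext fun i j => ?_)
  change f ((Matrix.scalar (Fin n) (r : R)) i j) = (Matrix.scalar (Fin n) (f r)) i j
  by_cases h : i = j
  · subst h; simp
  · simp [h]

/-- **Central sign lemma for `GL_n` over a number field (checked):** for every level `K ≤ GL_n(𝔸_{F,f})`,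
coefficients `M`, degree `i` and `r ∈ F^×`, the Hecke operator of the principal scalar finite idèle `r·1` — in
particular of `(-1)·1` — is the identity on `H^i(X_K, M)`.  Hence the central character `ψ̂` of any simultaneous
Hecke eigenclass is trivial on `F^×` embedded in the FINITE idèles; over `ℚ` with `K ⊇` a principal congruence subgroup,
`ψ̂` is an EVEN Dirichlet character (RefutationSketch.md §2). [cite: SerreLocalFields1979, Ch. VII §5, Prop. 3] -/
theorem heckeEnd_principalScalar_apply (n : ℕ) (F : Type) [Field F] [NumberField F] (k : Type) [CommRing k]
    (K : Subgroup (GL (Fin n) (FiniteAdeleRing (𝓞 F) F))) (M : Type) [AddCommGroup M] [Module k M] (r : Fˣ)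
    (i : ℕ) (x : ArithmeticQuotient.cohomology k
      (Matrix.GeneralLinearGroup.map (algebraMap F (FiniteAdeleRing (𝓞 F) F))) K M i) :
    ArithmeticQuotient.heckeEnd k K
      (Matrix.GeneralLinearGroup.map (algebraMap F (FiniteAdeleRing (𝓞 F) F)) (glScalar n F r)) M
      (Matrix.GeneralLinearGroup.map (algebraMap F (FiniteAdeleRing (𝓞 F) F))) i x = x :=
  heckeEnd_apply_of_mem_center k _ K M (glScalar_mem_center n F r)
    (by rw [map_glScalar]; exact glScalar_mem_center _ _ _) i x

end CentralSign

end Summit.Langlands.Langlands.Cruxes.MonomialSerreAtSplitPrimes.Birth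

end
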